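import Literature.Computability.QuantumComplexity.RevGadgets
import HarnessLib

/-!
# Guarding a classical straight-line program by a flag wire

Topic `Literature/Computability/QuantumComplexity`; sequel of `RevGadgets.lean` (`ClOp`, `clEval`). A universal
quantum machine that carries several compiled copies ("slots") of a classical stage, only one of which is meant
to run on a given input, guards every operation of slot `s` by a FLAG wire: `NOT i ↦ CNOT flag i`,
`CNOT i j ↦ Toffoli flag i j`, and — a Toffoli having only two controls — `Toffoli a b c ↦
Toffoli flag a s; Toffoli s b c; Toffoli flag a s` with a scratch wire `s` (compute `flag ∧ a`, use it,
uncompute). We prove the semantics: with the flag ON (and the scratch clean) the guarded program computes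
exactly what the program computes; with the flag OFF it is the identity.

* `ClOp.guardBy`, `guardOps` — the transformation;
* `ClOp.clEval_guardBy` — one operation: `clEval (op.guardBy flag s) w = if w flag then op.eval w else w`;
* **`clEval_guardOps_of_flag`**, **`clEval_guardOps_of_not_flag`** — whole programs.

Used for the flag-controlled stages of the universal circuit of Regev's one-copy sampler (J. ACM 56 (2009),
art. 34, Lemma 3.14): an inactive slot's guarded program is the identity (so its wires are idle), the active
slot's is the plain program.

Everything is proved; no named fact is introduced.

## References

* M. A. Nielsen, I. L. Chuang, *Quantum Computation and Quantum Information*, CUP 2010, §3.2.5, §4.3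
  (controlled operations; Figure 4.10: adding controls with work qubits) [NielsenChuang2010].
* A. Barenco et al., *Elementary gates for quantum computation*, Phys. Rev. A 52 (1995) 3457, §7 (Lemma 7.2:
  multiply-controlled gates with work bits) [BarencoEtAl1995].
* O. Regev, *On lattices, learning with errors, random linear codes, and cryptography*, J. ACM 56 (2009),
  art. 34, Lemma 3.14 (proof) [Regev2009].
-/

namespace Literature.Computability.QuantumComplexity

variable {ι : Type*}

namespace ClOp

/-- **Guarding one operation by a flag** (scratch wire `s` for the Toffoli). [cite: NielsenChuang2010, §4.3 Figure 4.10] [cite: BarencoEtAl1995, §7 Lemma 7.2] -/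
def guardBy (flag s : ι) : ClOp ι → List (ClOp ι)
  | not i => [cnot flag i]
  | cnot i j => [toffoli flag i j]
  | toffoli a b c => [toffoli flag a s, toffoli s b c, toffoli flag a s]

/-- **Freshness of the flag and the scratch wire** for an operation: the flag is not its target, the scratch
wire is none of its wires, the flag is not a control either, and the two differ. [folklore] -/
structure Fresh (flag s : ι) (op : ClOp ι) : Prop where
  flag_ne : flag ≠ op.target
  flag_nmem : flag ∉ op.controls
  s_ne_target : s ≠ op.target
  s_nmem : s ∉ op.controls
  flag_ne_s : flag ≠ s

variable [DecidableEq ι]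

set_option linter.unusedSimpArgs false in
/-- **Semantics of one guarded operation**: with a clean scratch wire, the guarded block performs the operation
iff the flag is set (and leaves the scratch wire clean). [cite: NielsenChuang2010, §4.3 Figure 4.10] -/
theorem clEval_guardBy (flag s : ι) (op : ClOp ι) (hwf : op.WF) (hf : Fresh flag s op) (w : ι → Bool) (hs : w s = false) :
    clEval (op.guardBy flag s) w = if w flag then op.eval w else w := by
  cases op with
  | not i =>
    funext x
    simp only [guardBy, clEval_cons, clEval_nil, eval, guard, target]
    by_cases hx : x = i
    · subst hx
      cases hfl : w flag <;> simp
    · cases hfl : w flag <;> simp [hx]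
  | cnot i j =>
    funext x
    simp only [guardBy, clEval_cons, clEval_nil, eval, guard, target]
    by_cases hx : x = j
    · subst hx
      cases hfl : w flag <;> simp
    · cases hfl : w flag <;> simp [hx]
  | toffoli a b c =>
    have hfc : flag ≠ c := hf.flag_ne
    have hsc : s ≠ c := hf.s_ne_target
    have hsa : s ≠ a := fun h => hf.s_nmem (by simp [controls, h])
    have hsb : s ≠ b := fun h => hf.s_nmem (by simp [controls, h])
    have hfs : flag ≠ s := hf.flag_ne_s
    have hac : a ≠ c := hwf.2.1
    have hbc : b ≠ c := hwf.2.2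
    funext x
    simp only [guardBy, clEval_cons, clEval_nil, ite_apply, eval_apply, guard, target, hs]
    by_cases hxs : x = s
    · subst hxs
      simp [hs, hsa.symm, hsb.symm, hsc.symm, hsc, hfs.symm, hfs, hfc.symm, hac.symm]
      all_goals (cases w flag <;> cases w a <;> cases w b <;> simp_all)
    · by_cases hxc : x = c
      · subst hxc
        simp [hxs, Ne.symm hxs, hsa.symm, hsb.symm, hsc.symm, hsc, hfs.symm, hfs, hfc.symm, hfc, hac.symm, hac, hbc.symm, hbc]
        all_goals (cases w flag <;> cases w a <;> cases w b <;> simp_all)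
      · simp [hxs, Ne.symm hxs, hxc, Ne.symm hxc, hsa.symm, hsb.symm, hsc.symm, hsc, hfs.symm, hfs, hfc.symm, hfc, hac.symm, hac]

end ClOp

/-- **Guarding a program by a flag.** [cite: NielsenChuang2010, §4.3 Figure 4.10] -/
def guardOps (flag s : ι) (ops : List (ClOp ι)) : List (ClOp ι) := ops.flatMap (ClOp.guardBy flag s)

variable [DecidableEq ι]

/-- **Flag ON: the guarded program computes the program** (scratch clean, flag and scratch fresh for every
operation). [cite: NielsenChuang2010, §4.3] [cite: Regev2009, Lemma 3.14 (proof)] -/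
theorem clEval_guardOps_of_flag (flag s : ι) :
    ∀ (ops : List (ClOp ι)), (∀ op ∈ ops, op.WF) → (∀ op ∈ ops, ClOp.Fresh flag s op) →
      ∀ (w : ι → Bool), w s = false → w flag = true → clEval (guardOps flag s ops) w = clEval ops w
  | [], _, _, _, _, _ => rfl
  | op :: ops, hwf, hfr, w, hs, hfl => by
    rw [guardOps, List.flatMap_cons, clEval_append, ← guardOps,
      ClOp.clEval_guardBy flag s op (hwf op List.mem_cons_self) (hfr op List.mem_cons_self) w hs, if_pos hfl, clEval_cons]
    have hfr₀ := hfr op List.mem_cons_self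
    exact clEval_guardOps_of_flag flag s ops (fun o ho => hwf o (List.mem_cons_of_mem op ho))
      (fun o ho => hfr o (List.mem_cons_of_mem op ho)) _
      (by rw [ClOp.eval_apply_of_ne op w hfr₀.s_ne_target, hs]) (by rw [ClOp.eval_apply_of_ne op w hfr₀.flag_ne, hfl])

/-- **Flag OFF: the guarded program is the identity.** [cite: NielsenChuang2010, §4.3] [cite: Regev2009, Lemma 3.14 (proof)] -/
theorem clEval_guardOps_of_not_flag (flag s : ι) :
    ∀ (ops : List (ClOp ι)), (∀ op ∈ ops, op.WF) → (∀ op ∈ ops, ClOp.Fresh flag s op) →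
      ∀ (w : ι → Bool), w s = false → w flag = false → clEval (guardOps flag s ops) w = w
  | [], _, _, _, _, _ => rfl
  | op :: ops, hwf, hfr, w, hs, hfl => by
    rw [guardOps, List.flatMap_cons, clEval_append, ← guardOps,
      ClOp.clEval_guardBy flag s op (hwf op List.mem_cons_self) (hfr op List.mem_cons_self) w hs, if_neg (by rw [hfl]; decide)]
    exact clEval_guardOps_of_not_flag flag s ops (fun o ho => hwf o (List.mem_cons_of_mem op ho))
      (fun o ho => hfr o (List.mem_cons_of_mem op ho)) w hs hfl

omit [DecidableEq ι] in
/-- The guarded program is well formed when the program is and the flag / scratch are fresh. [folklore] -/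
theorem guardOps_wf (flag s : ι) (ops : List (ClOp ι)) (hwf : ∀ op ∈ ops, op.WF) (hfr : ∀ op ∈ ops, ClOp.Fresh flag s op) :
    ∀ op ∈ guardOps flag s ops, op.WF := by
  intro op hop
  rw [guardOps, List.mem_flatMap] at hop
  obtain ⟨o, ho, hop⟩ := hop
  have hf := hfr o ho
  have hw := hwf o ho
  cases o with
  | not i =>
    simp only [ClOp.guardBy, List.mem_singleton] at hop
    subst hop
    exact hf.flag_ne
  | cnot i j =>
    simp only [ClOp.guardBy, List.mem_singleton] at hop
    subst hop
    exact ⟨fun h => hf.flag_nmem (by simp [ClOp.controls, h]), hf.flag_ne, hw⟩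
  | toffoli a b c =>
    have hsa : s ≠ a := fun h => hf.s_nmem (by simp [ClOp.controls, h])
    have hsb : s ≠ b := fun h => hf.s_nmem (by simp [ClOp.controls, h])
    simp only [ClOp.guardBy, List.mem_cons, List.not_mem_nil, or_false] at hop
    have hfa : flag ≠ a := fun h => hf.flag_nmem (by simp [ClOp.controls, h])
    rcases hop with rfl | rfl | rfl
    · exact ⟨hfa, hf.flag_ne_s, hsa.symm⟩
    · exact ⟨hsb, hf.s_ne_target, hw.2.2⟩
    · exact ⟨hfa, hf.flag_ne_s, hsa.symm⟩

end Literature.Computability.QuantumComplexity
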